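import Mathlib
import Summits.Ventures.PercRepro2.TypedOA3Edge
import Summits.Ventures.PercRepro2.TypedOEdgeTypeTwo
import Summits.Ventures.PercRepro2.TypedCoincidence
import Summits.Ventures.PercRepro2.TypedContract

/-!
# The `a₃`-edge at a mark `o` of typed degree two, type 2: worth exactly the deletion (blind cell
PercRepro2, night-3 g17, 2026-08-27; NIGHT3-CERT.md §26.10)

With `f = {o, a₃}` pinned open the count vanishes (`typedCount_o_a3_open`: `o = a₃` in every copy,
`TypedA3.typedCount_eq_zero_of_o_eq_a3`), so «type 2 = type 1 + pinned open − deleted» at `f`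
(`typedCount_o_edge_type_two`, with the other typed edge `e` at `o` of type `1`) reads
`N(τ[f := 1]) = N(τ[f := 0]) + N(τ[f := 2])` (`typedCount_o_a3_edge_split`); with g16's reduction
`N(τ[f := 1]) = 2 · N(τ[f := 0])` (`typedCount_o_a3_edge`) this gives

  `N(τ[f := 2]) = N(τ[f := 0])`   (`typedCount_o_a3_edge_two`)

— at a degree-two `o` an `a₃`-edge of type `2` contributes exactly the count with it deleted, as an
`a₃`-edge of type `1` contributes twice that count.  Own work; standard axioms.
-/

namespace Summit.Ventures.PercRepro2

namespace CovForm

namespace TypedRed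

open OneTyped Contract TypedA3

section Main

open Classical

variable {V : Type*} {E : Type*} [Fintype E] [DecidableEq E] {R : Type*} [Field R]

variable (ends : E → Sym2 V) (o a₁ a₂ a₃ b : V)

/-- **An `a₃`-edge at `o` pinned open kills the count**: `f = {o, a₃}` of type `3`. -/
theorem typedCount_o_a3_open {f : E} (hf : ends f = s(o, a₃)) (F : Finset E) (hfF : f ∈ F)
    (z : Config E) (τ : E → ℕ) (hτ : τ f = 3) :
    typedCount F z τ (K3 ends o a₁ a₂ a₃ b : Config E → Config E → Config E → R) = 0 := by
  rw [typedCount_type_three F f hfF z τ hτ]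
  have hf' : ends f = s(a₃, o) := by rw [hf, Sym2.eq_swap]
  rw [typedCount_contract_open ends o a₁ a₂ a₃ b hf' (F.erase f) (Finset.notMem_erase f F)
    (Function.update z f true) (by simp) τ]
  rw [contractMap_of_mem (by simp : o ∈ ({a₃, o} : Finset V)),
    contractMap_of_mem (by simp : a₃ ∈ ({a₃, o} : Finset V)), typedCount_eq_zero_of_o_eq_a3]

/-- **The split at an `a₃`-edge of `o`**: with `e` (of type `1`) the only other typed edge at `o`,
`N(τ[f := 1]) = N(τ[f := 0]) + N(τ[f := 2])`. -/
theorem typedCount_o_a3_edge_split {e f : E} (hf : ends f = s(o, a₃)) (hef : e ≠ f)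
    (ho1 : o ≠ a₁) (ho2 : o ≠ a₂) (ho3 : o ≠ a₃) (hob : o ≠ b) (F : Finset E) (heF : e ∈ F)
    (hfF : f ∈ F) (z : Config E) (τ : E → ℕ) (hτe : τ e = 1)
    (hcl : ∀ e', e' ≠ e → e' ≠ f → o ∈ ends e' → e' ∉ F ∧ z e' = false) :
    typedCount F z (Function.update τ f 1)
        (K3 ends o a₁ a₂ a₃ b : Config E → Config E → Config E → R) =
      typedCount F z (Function.update τ f 0) (K3 ends o a₁ a₂ a₃ b) +
        typedCount F z (Function.update τ f 2) (K3 ends o a₁ a₂ a₃ b) := by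
  have hcl' : ∀ e', e' ≠ f → e' ≠ e → o ∈ ends e' → e' ∉ F ∧ z e' = false :=
    fun e' h1 h2 h3 => hcl e' h2 h1 h3
  have h := typedCount_o_edge_type_two (R := R) ends o a₁ a₂ a₃ b (e := f) (f := e) (u := a₃) hf ho3
    hef.symm ho1 ho2 ho3 hob F hfF heF z τ hτe hcl'
  rw [typedCount_o_a3_open ends o a₁ a₂ a₃ b hf F hfF z _ (Function.update_self _ _ _)] at h
  linear_combination -h

/-- **An `a₃`-edge of type `2` at a degree-two `o` is worth exactly the deletion**: with
`e = {o, u}` of type `1`, `f = {o, a₃}` of type `1` in `τ`, the other edges at `o` pinned closed,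
`N(τ[f := 2]) = N(F ∖ f, f pinned closed)`. -/
theorem typedCount_o_a3_edge_two {e f : E} {u : V} (he : ends e = s(o, u)) (hf : ends f = s(o, a₃))
    (hou : o ≠ u) (hef : e ≠ f) (ho1 : o ≠ a₁) (ho2 : o ≠ a₂) (ho3 : o ≠ a₃) (hob : o ≠ b)
    (F : Finset E) (heF : e ∈ F) (hfF : f ∈ F) (z : Config E) (τ : E → ℕ) (hτe : τ e = 1)
    (hτf : τ f = 1) (hcl : ∀ e', e' ≠ e → e' ≠ f → o ∈ ends e' → e' ∉ F ∧ z e' = false) :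
    typedCount F z (Function.update τ f 2)
        (K3 ends o a₁ a₂ a₃ b : Config E → Config E → Config E → R) =
      typedCount (F.erase f) (Function.update z f false) τ (K3 ends o a₁ a₂ a₃ b) := by
  have h1 := typedCount_o_a3_edge (R := R) ends o a₁ a₂ a₃ b he hf hou hef ho1 ho2 ho3 hob F heF
    hfF z τ hτe hτf hcl
  have h2 := typedCount_o_a3_edge_split (R := R) ends o a₁ a₂ a₃ b hf hef ho1 ho2 ho3 hob F heF hfF
    z τ hτe hcl
  have hτ1 : Function.update τ f 1 = τ := by
    rw [← hτf]; exact Function.update_eq_self f τ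
  rw [hτ1] at h2
  have h0 : typedCount F z (Function.update τ f 0)
      (K3 ends o a₁ a₂ a₃ b : Config E → Config E → Config E → R) =
      typedCount (F.erase f) (Function.update z f false) τ (K3 ends o a₁ a₂ a₃ b) := by
    rw [typedCount_type_zero F f hfF z _ (Function.update_self _ _ _)]
    exact typedCount_congr_τ (F.erase f) _
      (fun e' he' => Function.update_of_ne (Finset.ne_of_mem_erase he') _ _) _
  rw [h0] at h2
  linear_combination h1 - h2

end Main

end TypedRed

end CovForm

end Summit.Ventures.PercRepro2
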